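import Mathlib
import Summits.Ventures.HodgeRepro2.T6N42HypFlath

/-!
# T6N42FlathTransfer — smoothness, admissibility and irreducibility TRANSPORT along intertwining
equivalences and continuous homomorphisms: the glue the host `d42` needs to read the Flath components
(`T6N42FlathMain.components`) as the `π` of its dual-pair data (owner t6-p5)

The host instantiation will present `π₀,v` on the datum's own carrier (`DualPairDatum.Vπ`, group
`DualPairDatum.G`), related to the component `(components … v).ρ` by an intertwining linear
equivalence and, for the group, by a continuous isomorphism / the inclusion `G(W) → G(W) × H(V)`.
This file proves, for `ρ` on `V` and `σ` on `W` over groups with a topology: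
* `stabilizer_of_equiv`, `IsSmooth.of_equiv`: smoothness transports along an intertwining `V ≃ₗ[ℂ] W`;
* `invariantsOf_of_equiv`, `IsAdmissible.of_equiv`: so does admissibility (Definition 5.4);
* `subrepEquiv`, `IsIrreducible.of_equiv`: so does irreducibility (an order isomorphism
  `Subrepresentation ρ ≃o Subrepresentation σ`);
* `stabilizer_comp`, `IsSmooth.comp_of_continuous`: smoothness of `ρ ∘ f` for a continuous
  homomorphism `f : H →* G` (pull-back of open stabilisers) — in particular `IsSmooth.fst` for the
  restriction of a representation of `G × H` to `G × {1}` (`DualPairDatum.ωG`);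
* `subrepCompMulEquiv`, `IsIrreducible.comp_mulEquiv`: irreducibility is invariant under
  pre-composition with a group isomorphism (the datum's group vs the shape's `G(F_v)`).
Generic kernel lemmas; no display, no route object.

README §8(d): uses an L-value-free non-vanishing device: NO (TIER5 §N4.2, a pre-02:16Z line of
record, continued).

Filed in Tier-6 WAVE 1 as p437811 (proposed 2026-08-26T10:23:33Z, ACCEPTED, commit 7563dfe08d9d);
this v2 differs from the filed bytes in this module docstring only (the staged-record wording
dropped; every declaration byte-identical to v1).
-/

namespace Summit.Ventures.HodgeRepro2.T6.N42Flath

open Summit.Ventures.HodgeRepro2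

section Equiv

variable {G : Type*} [Group G] [TopologicalSpace G]
variable {V W : Type*} [AddCommGroup V] [Module ℂ V] [AddCommGroup W] [Module ℂ W]
variable {ρ : Representation ℂ G V} {σ : Representation ℂ G W}

omit [TopologicalSpace G] in
/-- The stabiliser of `w` under `σ` is the stabiliser of `e.symm w` under `ρ`, for an intertwining
equivalence `e`. -/
theorem stabilizer_of_equiv (e : V ≃ₗ[ℂ] W) (he : ∀ g v, e (ρ g v) = σ g (e v)) (w : W) :
    LevelPositivity.stabilizer σ w = LevelPositivity.stabilizer ρ (e.symm w) := by
  refine Subgroup.ext fun g => ?_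
  show σ g w = w ↔ ρ g (e.symm w) = e.symm w
  constructor
  · intro h
    apply e.injective
    rw [he, e.apply_symm_apply, h]
  · intro h
    have h' := congrArg e h
    rwa [he, e.apply_symm_apply] at h'

/-- Smoothness transports along an intertwining linear equivalence. -/
theorem IsSmooth.of_equiv (e : V ≃ₗ[ℂ] W) (he : ∀ g v, e (ρ g v) = σ g (e v))
    (h : LevelPositivity.IsSmooth ρ) : LevelPositivity.IsSmooth σ := by
  intro w
  rw [stabilizer_of_equiv e he w]
  exact h _

omit [TopologicalSpace G] in
/-- Membership in the `K`-invariants of `ρ`. -/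
theorem mem_invariantsOf_iff (K : Subgroup G) (v : V) :
    v ∈ invariantsOf ρ K ↔ ∀ k : K, ρ (k : G) v = v := by
  simp only [invariantsOf, Representation.mem_invariants, restrictTo_apply]

omit [TopologicalSpace G] in
/-- The `K`-invariants transport along an intertwining equivalence. -/
theorem invariantsOf_of_equiv (e : V ≃ₗ[ℂ] W) (he : ∀ g v, e (ρ g v) = σ g (e v))
    (K : Subgroup G) : invariantsOf σ K = (invariantsOf ρ K).map (e : V →ₗ[ℂ] W) := by
  rw [Submodule.map_equiv_eq_comap_symm]
  ext w
  rw [Submodule.mem_comap, LinearEquiv.coe_coe, mem_invariantsOf_iff, mem_invariantsOf_iff]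
  constructor
  · intro h k
    apply e.injective
    rw [he, e.apply_symm_apply, h]
  · intro h k
    have h' := congrArg e (h k)
    rwa [he, e.apply_symm_apply] at h'

/-- Admissibility (Definition 5.4) transports along an intertwining linear equivalence. -/
theorem IsAdmissible.of_equiv (e : V ≃ₗ[ℂ] W) (he : ∀ g v, e (ρ g v) = σ g (e v))
    (h : IsAdmissible ρ) : IsAdmissible σ := by
  refine ⟨IsSmooth.of_equiv e he h.1, fun K hK hKc => ?_⟩
  haveI := h.2 K hK hKc
  rw [invariantsOf_of_equiv e he K]
  exact Module.Finite.map _ _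

omit [TopologicalSpace G] in
/-- The image of a subrepresentation of `ρ` under an intertwining equivalence is a subrepresentation
of `σ`. -/
def Subrepresentation.mapEquiv (e : V ≃ₗ[ℂ] W) (he : ∀ g v, e (ρ g v) = σ g (e v))
    (U : Subrepresentation ρ) : Subrepresentation σ where
  toSubmodule := U.toSubmodule.map (e : V →ₗ[ℂ] W)
  apply_mem_toSubmodule := by
    intro g w hw
    rcases Submodule.mem_map.1 hw with ⟨v, hv, rfl⟩
    exact Submodule.mem_map.2 ⟨ρ g v, U.apply_mem_toSubmodule g hv, he g v⟩

omit [TopologicalSpace G] in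
/-- The intertwining equivalence read backwards. -/
theorem symm_intertwining (e : V ≃ₗ[ℂ] W) (he : ∀ g v, e (ρ g v) = σ g (e v)) (g : G) (w : W) :
    e.symm (σ g w) = ρ g (e.symm w) := by
  apply e.injective
  rw [e.apply_symm_apply, he, e.apply_symm_apply]

omit [TopologicalSpace G] in
/-- The lattice of subrepresentations transports along an intertwining equivalence. -/
def subrepEquiv (e : V ≃ₗ[ℂ] W) (he : ∀ g v, e (ρ g v) = σ g (e v)) :
    Subrepresentation ρ ≃o Subrepresentation σ where
  toFun := Subrepresentation.mapEquiv e he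
  invFun := Subrepresentation.mapEquiv e.symm (symm_intertwining e he)
  left_inv U := by
    apply Subrepresentation.toSubmodule_injective
    show (U.toSubmodule.map (e : V →ₗ[ℂ] W)).map (e.symm : W →ₗ[ℂ] V) = U.toSubmodule
    rw [← Submodule.map_comp]
    simp
  right_inv U := by
    apply Subrepresentation.toSubmodule_injective
    show (U.toSubmodule.map (e.symm : W →ₗ[ℂ] V)).map (e : V →ₗ[ℂ] W) = U.toSubmodule
    rw [← Submodule.map_comp]
    simp
  map_rel_iff' {U₁ U₂} := by
    show U₁.toSubmodule.map (e : V →ₗ[ℂ] W) ≤ U₂.toSubmodule.map (e : V →ₗ[ℂ] W) ↔ U₁ ≤ U₂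
    rw [Submodule.map_le_map_iff_of_injective e.injective]
    exact Iff.rfl

omit [TopologicalSpace G] in
/-- Irreducibility transports along an intertwining linear equivalence. -/
theorem IsIrreducible.of_equiv (e : V ≃ₗ[ℂ] W) (he : ∀ g v, e (ρ g v) = σ g (e v))
    (h : ρ.IsIrreducible) : σ.IsIrreducible :=
  (subrepEquiv e he).symm.isSimpleOrder

end Equiv

section Comp

variable {G H : Type*} [Group G] [TopologicalSpace G] [Group H] [TopologicalSpace H]
variable {V : Type*} [AddCommGroup V] [Module ℂ V]

omit [TopologicalSpace G] [TopologicalSpace H] in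
/-- The stabiliser under `ρ ∘ f` is the pull-back of the stabiliser under `ρ`. -/
theorem stabilizer_comp (ρ : Representation ℂ G V) (f : H →* G) (v : V) :
    LevelPositivity.stabilizer (ρ.comp f) v = (LevelPositivity.stabilizer ρ v).comap f :=
  Subgroup.ext fun _ => Iff.rfl

/-- `ρ ∘ f` is smooth when `ρ` is and `f` is continuous. -/
theorem IsSmooth.comp_of_continuous {ρ : Representation ℂ G V} (f : H →* G) (hf : Continuous f)
    (h : LevelPositivity.IsSmooth ρ) : LevelPositivity.IsSmooth (ρ.comp f) := by
  intro v
  rw [stabilizer_comp, Subgroup.coe_comap]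
  exact (h v).preimage hf

/-- The restriction of a smooth representation of `G × H` to `G × {1}` is smooth. -/
theorem IsSmooth.fst {ρ : Representation ℂ (G × H) V} (h : LevelPositivity.IsSmooth ρ) :
    LevelPositivity.IsSmooth (ρ.comp (MonoidHom.inl G H)) :=
  IsSmooth.comp_of_continuous (MonoidHom.inl G H) (continuous_id.prodMk continuous_const) h

end Comp

section MulEquiv

variable {G H : Type*} [Group G] [Group H]
variable {V : Type*} [AddCommGroup V] [Module ℂ V]

/-- The representation `ρ ∘ φ` of `H` for a group isomorphism `φ : H ≃* G`. -/
def compMulEquiv (ρ : Representation ℂ G V) (φ : H ≃* G) : Representation ℂ H V :=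
  ρ.comp φ.toMonoidHom

/-- `ρ ∘ φ` acts as `ρ (φ h)`. -/
theorem compMulEquiv_apply (ρ : Representation ℂ G V) (φ : H ≃* G) (h : H) :
    compMulEquiv ρ φ h = ρ (φ h) := rfl

/-- A subrepresentation of `ρ` is a subrepresentation of `ρ ∘ φ` (the same submodule; invariance
under `φ(H) = G`). -/
def subrepToMulEquiv (ρ : Representation ℂ G V) (φ : H ≃* G)
    (U : Subrepresentation ρ) : Subrepresentation (compMulEquiv ρ φ) where
  toSubmodule := U.toSubmodule
  apply_mem_toSubmodule := fun h _ hv => U.apply_mem_toSubmodule (φ h) hv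

/-- … and conversely. -/
def subrepOfMulEquiv (ρ : Representation ℂ G V) (φ : H ≃* G)
    (U : Subrepresentation (compMulEquiv ρ φ)) : Subrepresentation ρ where
  toSubmodule := U.toSubmodule
  apply_mem_toSubmodule := fun g v hv => by
    have := U.apply_mem_toSubmodule (φ.symm g) hv
    rwa [compMulEquiv_apply, MulEquiv.apply_symm_apply] at this

/-- The lattices of subrepresentations of `ρ` and of `ρ ∘ φ` coincide. -/
def subrepCompMulEquiv (ρ : Representation ℂ G V) (φ : H ≃* G) :
    Subrepresentation ρ ≃o Subrepresentation (compMulEquiv ρ φ) where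
  toFun := subrepToMulEquiv ρ φ
  invFun := subrepOfMulEquiv ρ φ
  left_inv _ := rfl
  right_inv _ := rfl
  map_rel_iff' := Iff.rfl

/-- Irreducibility is invariant under pre-composition with a group isomorphism. -/
theorem IsIrreducible.comp_mulEquiv {ρ : Representation ℂ G V} (φ : H ≃* G)
    (h : ρ.IsIrreducible) : (compMulEquiv ρ φ).IsIrreducible :=
  (subrepCompMulEquiv ρ φ).symm.isSimpleOrder

end MulEquiv

end Summit.Ventures.HodgeRepro2.T6.N42Flath
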